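import Summits.ABC.ABC.Theorems.TwistAmplificationSharpModerateLawDefs
import Summits.ABC.ABC.Theorems.TwistAmplificationSharpModerateLawFieldSumLemmas
import Literature.NumberTheory.CubicFields.MaximalDiscriminantValuation
import Literature.NumberTheory.CubicFields.UniformityEstimate
import Mathlib.SetTheory.Cardinal.NatCard

/-!
# Crux `TwistAmplification.SharpModerateLaw` (stmt-ABC-1975): the field sum `Σ h_max(D)/rad(D) ≪_ε N^ε`

Stub `stub_fieldSum` of the line `syzygy-lattice-half-deep-few-primes` (lead
`prover-line-stmt-ABC-1975-0`), in CONDITIONAL form: the registered signature `FieldSum`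
(`Σ_{0<|D|≤N} h_max(D)/rad(|D|) ≤ C_ε N^ε`, `h_max(D)` = number of `GL₂(ℤ)`-orbits of MAXIMAL
integral binary cubic forms of discriminant `D`, `…Defs.lean` §C) is proved from ONE published input
not proved in the tree, the named fact `Literature.NumberTheory.CubicFields.btt_uniformity_sqDvd`
(`Literature/NumberTheory/CubicFields/UniformityEstimate.lean`):

* (H) Bhargava–Taniguchi–Thorne 2023, Prop. 4.5 (the Davenport–Heilbronn / Belabas–Bhargava–Pomerance
  uniformity estimate): for squarefree `q`, `#{cubic rings R : q² ∣ Disc R, 0 < ±Disc R < X} ≪ 6^{ω(q)} X/q²`.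

Proof of `stub_fieldSum : btt_uniformity_sqDvd → FieldSum` (everything else PROVED, here and in
`…FieldSumLemmas.lean`, `Literature…SingularZeroModP.lean`, `Literature…MaximalDiscriminantValuation.lean`):
1. `h_max(D) ≤ h(D)` (`classNumber`, all orbits), and if `h_max(D) ≠ 0` then `D = Disc g` for a
   maximal `g`, so by `Literature…MaximalDiscriminantValuation` (`U_p`-analysis, proved):
   `p³ ∤ D` (`p ≥ 5`), `2⁴ ∤ D`, `3⁶ ∤ D`; hence `|D| ∣ 324 · v(|D|) · rad|D|` with
   `v = depthRad` (Kane's repeated radical, squarefree, `v² ∣ |D|`), i.e.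
   `h_max(D)/rad|D| ≤ 324 · h(D) · v(|D|)/|D|` (`hmax_div_radical_le`);
2. grouping by `q = v(|D|)` (squarefree, `q² ∣ D`): `Σ_D h(D) v/|D| ≤ Σ_{q sqfree ≤ N} q Σ_{q²∣D} h(D)/|D|`;
3. Abel summation with the partial sums `Σ_{0<|D|≤M, q²∣D} h(D) ≤ 4C·6^{ω(q)} M/q²` from (H):
   `Σ_{q² ∣ D} h(D)/|D| ≤ 4C·6^{ω(q)} (1 + log N)/q²`;
4. `Σ_{q ≤ N} 6^{ω(q)}/q ≤ M_δ N^δ (1 + log N)` (divisor bound) and `1 + log N ≤ (1 + 1/δ) N^δ`,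
   `δ = ε/3`.
No class field theory (Hasse's count of cubic fields of discriminant `d₀f²`) and no mean value of
`#Cl(ℚ(√d))[3]` is needed on this road.
-/

noncomputable section

namespace Summit.ABC.ABC.Theorems.SharpModerateLaw

open Literature.NumberTheory.CubicFields
open UniqueFactorizationMonoid (radical)
open Finset Real

/-! ## Step 1: `h_max(D)/rad|D| ≤ 324 · h(D) · v(|D|)/|D|` -/

/-- `h_max(D) ≤ h(D)`: maximal orbits among all orbits of discriminant `D ≠ 0`. -/
theorem hmax_le_classNumber {D : ℤ} (hD : D ≠ 0) : hmax D ≤ classNumber D := by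
  haveI := finite_orbitsOfDisc hD
  exact Finite.card_subtype_le _

/-- If `h_max(D) ≠ 0` (`D ≠ 0`) then `D` is the discriminant of a maximal form. -/
theorem exists_isMaximal_of_hmax_ne_zero {D : ℤ} (h : hmax D ≠ 0) :
    ∃ g : BinaryCubic ℤ, RingOfForm.IsMaximal g ∧ g.disc = D := by
  obtain ⟨⟨O, hO⟩⟩ := (Nat.card_ne_zero.mp h).1
  exact ⟨orbitRep O, hO, (orbitRep_spec O).2⟩

/-- **The shape of a maximal discriminant, as a bound on `1/rad`**: for `D ≠ 0`,
`h_max(D)/rad|D| ≤ 324 · h(D) · v(|D|)/|D|` (`v = depthRad`; by `p³ ∤ D` for `p ≥ 5`, `2⁴ ∤ D`,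
`3⁶ ∤ D` when a maximal form of discriminant `D` exists, `…MaximalDiscriminantValuation`). -/
theorem hmax_div_radical_le {D : ℤ} (hD : D ≠ 0) :
    (hmax D : ℝ) / ((radical D.natAbs : ℕ) : ℝ) ≤
      324 * ((classNumber D : ℝ) * (depthRad D.natAbs : ℝ) / (D.natAbs : ℝ)) := by
  by_cases h0 : hmax D = 0
  · rw [h0, Nat.cast_zero, zero_div]; positivity
  obtain ⟨g, hg, hdisc⟩ := exists_isMaximal_of_hmax_ne_zero h0
  have hn : D.natAbs ≠ 0 := Int.natAbs_ne_zero.mpr hD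
  have hshape : ∀ p : ℕ, p.Prime → ¬ p ^ (if p = 2 then 4 else if p = 3 then 6 else 3) ∣ D.natAbs := by
    intro p hp; rw [← hdisc]; exact hg.not_pow_dvd_natAbs_disc hp
  have h2 : ¬ 2 ^ 4 ∣ D.natAbs := by simpa using hshape 2 Nat.prime_two
  have h3 : ¬ 3 ^ 6 ∣ D.natAbs := by simpa using hshape 3 Nat.prime_three
  have h5 : ∀ p : ℕ, p.Prime → 5 ≤ p → ¬ p ^ 3 ∣ D.natAbs := by
    intro p hp hp5
    have := hshape p hp
    rwa [if_neg (by omega), if_neg (by omega)] at this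
  have hrad := inv_radical_le hn h2 h3 h5
  have hle : (hmax D : ℝ) ≤ classNumber D := by exact_mod_cast hmax_le_classNumber hD
  calc (hmax D : ℝ) / ((radical D.natAbs : ℕ) : ℝ) = (hmax D : ℝ) * (1 / ((radical D.natAbs : ℕ) : ℝ)) := by
        rw [mul_one_div]
    _ ≤ (classNumber D : ℝ) * (324 * (depthRad D.natAbs : ℝ) / D.natAbs) :=
        mul_le_mul hle hrad (by positivity) (by positivity)
    _ = 324 * ((classNumber D : ℝ) * (depthRad D.natAbs : ℝ) / (D.natAbs : ℝ)) := by ring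

/-! ## Step 2: partial sums over `0 < |D| ≤ M`, `q² ∣ D`, from the named fact -/

/-- From (H): for squarefree `q` and `M ≥ 1`, `Σ_{0<|D|≤M, q²∣D} h(D) ≤ (4C·6^{ω(q)}/q²)·M`. -/
theorem partial_sums_le (hU : Literature.NumberTheory.CubicFields.btt_uniformity_sqDvd) : ∃ C₀ : ℝ, 0 ≤ C₀ ∧ ∀ q : ℕ, Squarefree q →
    ∀ M : ℕ, 1 ≤ M → ∑ D ∈ (Icc (-(M : ℤ)) M).erase 0,
      (if (q : ℤ) ^ 2 ∣ D then (classNumber D : ℝ) else 0) ≤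
        (4 * C₀ * 6 ^ q.primeFactors.card / (q : ℝ) ^ 2) * M := by
  obtain ⟨C, hC⟩ := hU
  refine ⟨max C 0, le_max_right _ _, fun q hq M hM => ?_⟩
  have hC' : ∀ s : ℤ, (s = 1 ∨ s = -1) → ∀ X : ℕ,
      ∑ D ∈ (discWindow s X).filter (fun D => (q : ℤ) ^ 2 ∣ D), (classNumber D : ℝ) ≤
        max C 0 * 6 ^ q.primeFactors.card * X / (q : ℝ) ^ 2 := by
    intro s hs X
    have h := hC q hq s hs X
    rw [Nat.cast_sum] at h
    refine h.trans ?_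
    gcongr
    exact le_max_left _ _
  -- the range `0 < |D| ≤ M` sits inside the two windows of height `M + 1`
  have hsub : ((Icc (-(M : ℤ)) M).erase 0).filter (fun D => (q : ℤ) ^ 2 ∣ D) ⊆
      (discWindow 1 (M + 1)).filter (fun D => (q : ℤ) ^ 2 ∣ D) ∪
        (discWindow (-1) (M + 1)).filter (fun D => (q : ℤ) ^ 2 ∣ D) := by
    intro D hD
    simp only [mem_filter, mem_erase, mem_Icc] at hD
    simp only [mem_union, mem_filter, mem_discWindow (Or.inl rfl), mem_discWindow (Or.inr rfl),
      Nat.cast_add, Nat.cast_one]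
    rcases lt_or_gt_of_ne hD.1.1 with h | h
    · right; exact ⟨⟨by omega, by omega⟩, hD.2⟩
    · left; exact ⟨⟨by omega, by omega⟩, hD.2⟩
  have hnn : ∀ D : ℤ, 0 ≤ (classNumber D : ℝ) := fun D => Nat.cast_nonneg _
  rw [← sum_filter]
  calc ∑ D ∈ ((Icc (-(M : ℤ)) M).erase 0).filter (fun D => (q : ℤ) ^ 2 ∣ D), (classNumber D : ℝ)
      ≤ ∑ D ∈ (discWindow 1 (M + 1)).filter (fun D => (q : ℤ) ^ 2 ∣ D) ∪
          (discWindow (-1) (M + 1)).filter (fun D => (q : ℤ) ^ 2 ∣ D), (classNumber D : ℝ) :=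
        sum_le_sum_of_subset_of_nonneg hsub fun D _ _ => hnn D
    _ ≤ ∑ D ∈ (discWindow 1 (M + 1)).filter (fun D => (q : ℤ) ^ 2 ∣ D), (classNumber D : ℝ) +
          ∑ D ∈ (discWindow (-1) (M + 1)).filter (fun D => (q : ℤ) ^ 2 ∣ D), (classNumber D : ℝ) := by
        rw [← sum_union_inter]
        exact le_add_of_nonneg_right (sum_nonneg fun D _ => hnn D)
    _ ≤ max C 0 * 6 ^ q.primeFactors.card * ((M + 1 : ℕ) : ℝ) / (q : ℝ) ^ 2 +
          max C 0 * 6 ^ q.primeFactors.card * ((M + 1 : ℕ) : ℝ) / (q : ℝ) ^ 2 :=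
        add_le_add (hC' 1 (Or.inl rfl) (M + 1)) (hC' (-1) (Or.inr rfl) (M + 1))
    _ ≤ (4 * max C 0 * 6 ^ q.primeFactors.card / (q : ℝ) ^ 2) * M := by
        have hM' : (1 : ℝ) ≤ M := by exact_mod_cast hM
        have h0 : 0 ≤ max C 0 * 6 ^ q.primeFactors.card / (q : ℝ) ^ 2 := by positivity
        push_cast
        have : max C 0 * 6 ^ q.primeFactors.card * ((M : ℝ) + 1) / (q : ℝ) ^ 2 +
            max C 0 * 6 ^ q.primeFactors.card * ((M : ℝ) + 1) / (q : ℝ) ^ 2 =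
            (max C 0 * 6 ^ q.primeFactors.card / (q : ℝ) ^ 2) * (2 * (M + 1)) := by ring
        rw [this, show (4 * max C 0 * 6 ^ q.primeFactors.card / (q : ℝ) ^ 2) * M =
          (max C 0 * 6 ^ q.primeFactors.card / (q : ℝ) ^ 2) * (4 * M) by ring]
        exact mul_le_mul_of_nonneg_left (by linarith) h0

/-! ## Step 3: the field sum -/

/-- Grouping by the repeated radical: for `0 < |D| ≤ N`,
`h(D) v(|D|)/|D| = Σ_{q squarefree ≤ N} [v(|D|) = q] · q · h(D)/|D|`. -/
theorem weight_eq_sum_ite {N : ℕ} {D : ℤ} (hD : D ∈ (Icc (-(N : ℤ)) N).erase 0) :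
    (classNumber D : ℝ) * (depthRad D.natAbs : ℝ) / (D.natAbs : ℝ) =
      ∑ q ∈ (Icc 1 N).filter Squarefree,
        if depthRad D.natAbs = q then (q : ℝ) * ((classNumber D : ℝ) / D.natAbs) else 0 := by
  simp only [mem_erase, mem_Icc] at hD
  have hn : D.natAbs ≠ 0 := Int.natAbs_ne_zero.mpr hD.1
  have hmem : depthRad D.natAbs ∈ (Icc 1 N).filter Squarefree := by
    simp only [mem_filter, mem_Icc]
    refine ⟨⟨depthRad_pos _, (depthRad_le hn).trans ?_⟩, squarefree_depthRad _⟩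
    have := hD.2; omega
  rw [sum_ite_eq, if_pos hmem]
  ring

/-- Termwise: `[v(|D|) = q] · q · h(D)/|D| ≤ q · [q² ∣ D] · h(D)/|D|` (as `v(|D|)² ∣ |D|`). -/
theorem ite_depthRad_le {D : ℤ} (hD : D ≠ 0) (q : ℕ) :
    (if depthRad D.natAbs = q then (q : ℝ) * ((classNumber D : ℝ) / D.natAbs) else 0) ≤
      (q : ℝ) * ((if (q : ℤ) ^ 2 ∣ D then (classNumber D : ℝ) else 0) / (D.natAbs : ℝ)) := by
  by_cases h1 : depthRad D.natAbs = q
  · have h2 : (q : ℤ) ^ 2 ∣ D := by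
      rw [← Nat.cast_pow, Int.ofNat_dvd_left, ← h1]
      exact depthRad_sq_dvd (Int.natAbs_ne_zero.mpr hD)
    rw [if_pos h1, if_pos h2]
  · rw [if_neg h1]
    positivity

/-- Abel summation for one `q`: `Σ_{0<|D|≤N, q²∣D} h(D)/|D| ≤ (4C·6^{ω(q)}/q²)(1 + log N)`. -/
theorem sum_sqDvd_div_le {C₀ : ℝ} (hC₀ : 0 ≤ C₀)
    (hC : ∀ q : ℕ, Squarefree q → ∀ M : ℕ, 1 ≤ M → ∑ D ∈ (Icc (-(M : ℤ)) M).erase 0,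
      (if (q : ℤ) ^ 2 ∣ D then (classNumber D : ℝ) else 0) ≤ (4 * C₀ * 6 ^ q.primeFactors.card / (q : ℝ) ^ 2) * M)
    {q : ℕ} (hq : Squarefree q) {N : ℕ} (hN : 1 ≤ N) :
    ∑ D ∈ (Icc (-(N : ℤ)) N).erase 0, (if (q : ℤ) ^ 2 ∣ D then (classNumber D : ℝ) else 0) / (D.natAbs : ℝ)
      ≤ (4 * C₀ * 6 ^ q.primeFactors.card / (q : ℝ) ^ 2) * (1 + Real.log N) :=
  sum_div_natAbs_le_of_partial_sums_le _ (fun D => by positivity) (by positivity) (hC q hq) hN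

/-- **Stub `stub_fieldSum` of crux stmt-ABC-1975 (line `syzygy-lattice-half-deep-few-primes`), conditional
form: the field sum from the uniformity estimate.** (BTT 2023 Prop. 4.5) ⇒
`Σ_{0<|D|≤N} h_max(D)/rad|D| ≤ C_ε N^ε` for every `ε > 0`. -/
theorem stub_fieldSum : Literature.NumberTheory.CubicFields.btt_uniformity_sqDvd → FieldSum := by
  intro hU ε hε
  obtain ⟨C₀, hC₀, hC⟩ := partial_sums_le hU
  have hδ : 0 < ε / 3 := by positivity
  obtain ⟨M, hM1, hM⟩ := exists_six_pow_card_primeFactors_le hδ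
  refine ⟨324 * (4 * C₀ * M * (1 + 1 / (ε / 3)) ^ 2), fun N hN => ?_⟩
  have hN' : (1 : ℝ) ≤ N := by exact_mod_cast hN
  have hNpos : (0 : ℝ) < N := by linarith
  set R := (Icc (-(N : ℤ)) N).erase 0 with hR
  set QN := (Icc 1 N).filter Squarefree with hQN
  set L : ℝ := 1 + Real.log N with hL
  have hL0 : 0 ≤ L := by have := Real.log_nonneg hN'; rw [hL]; linarith
  have hLδ : L ≤ (1 + 1 / (ε / 3)) * (N : ℝ) ^ (ε / 3) := one_add_log_le_rpow hδ hN
  -- Step 1, summed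
  have step1 : ∑ D ∈ R, (hmax D : ℝ) / ((radical D.natAbs : ℕ) : ℝ) ≤
      324 * ∑ D ∈ R, (classNumber D : ℝ) * (depthRad D.natAbs : ℝ) / (D.natAbs : ℝ) := by
    rw [mul_sum]
    refine sum_le_sum fun D hD => hmax_div_radical_le ?_
    exact (mem_erase.mp hD).1
  -- Step 2: group by `q = v(|D|)` and enlarge to `q² ∣ D`
  have step2 : ∑ D ∈ R, (classNumber D : ℝ) * (depthRad D.natAbs : ℝ) / (D.natAbs : ℝ) ≤
      ∑ q ∈ QN, (q : ℝ) * ∑ D ∈ R, (if (q : ℤ) ^ 2 ∣ D then (classNumber D : ℝ) else 0) / (D.natAbs : ℝ) := by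
    calc ∑ D ∈ R, (classNumber D : ℝ) * (depthRad D.natAbs : ℝ) / (D.natAbs : ℝ)
        = ∑ D ∈ R, ∑ q ∈ QN, (if depthRad D.natAbs = q then (q : ℝ) * ((classNumber D : ℝ) / D.natAbs) else 0) :=
          sum_congr rfl fun D hD => weight_eq_sum_ite hD
      _ = ∑ q ∈ QN, ∑ D ∈ R, (if depthRad D.natAbs = q then (q : ℝ) * ((classNumber D : ℝ) / D.natAbs) else 0) :=
          sum_comm
      _ ≤ ∑ q ∈ QN, ∑ D ∈ R, (q : ℝ) * ((if (q : ℤ) ^ 2 ∣ D then (classNumber D : ℝ) else 0) / (D.natAbs : ℝ)) := by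
          refine sum_le_sum fun q _ => sum_le_sum fun D hD => ite_depthRad_le (mem_erase.mp hD).1 q
      _ = ∑ q ∈ QN, (q : ℝ) * ∑ D ∈ R, (if (q : ℤ) ^ 2 ∣ D then (classNumber D : ℝ) else 0) / (D.natAbs : ℝ) := by
          refine sum_congr rfl fun q _ => ?_
          rw [mul_sum]
  -- Step 3: Abel summation for each `q`
  have step3 : ∑ q ∈ QN, (q : ℝ) * ∑ D ∈ R, (if (q : ℤ) ^ 2 ∣ D then (classNumber D : ℝ) else 0) / (D.natAbs : ℝ) ≤
      ∑ q ∈ QN, (q : ℝ) * ((4 * C₀ * 6 ^ q.primeFactors.card / (q : ℝ) ^ 2) * L) := by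
    refine sum_le_sum fun q hq => ?_
    have hq' := (mem_filter.mp hq).2
    exact mul_le_mul_of_nonneg_left (sum_sqDvd_div_le hC₀ hC hq' hN) (Nat.cast_nonneg _)
  -- Step 4: `Σ_{q ≤ N} 6^{ω(q)}/q ≤ M N^{ε/3} L`
  have step4 : ∑ q ∈ QN, (q : ℝ) * ((4 * C₀ * 6 ^ q.primeFactors.card / (q : ℝ) ^ 2) * L) ≤
      4 * C₀ * M * (N : ℝ) ^ (ε / 3) * L * L := by
    have hpt : ∀ q ∈ QN, (q : ℝ) * ((4 * C₀ * 6 ^ q.primeFactors.card / (q : ℝ) ^ 2) * L) ≤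
        4 * C₀ * M * (N : ℝ) ^ (ε / 3) * L * (1 / (q : ℝ)) := by
      intro q hq
      have hq1 : 1 ≤ q := (mem_Icc.mp (mem_filter.mp hq).1).1
      have hqN : q ≤ N := (mem_Icc.mp (mem_filter.mp hq).1).2
      have hq0 : (0 : ℝ) < q := by exact_mod_cast hq1
      have h6 : (6 : ℝ) ^ q.primeFactors.card ≤ M * (N : ℝ) ^ (ε / 3) := by
        refine (hM q (by omega)).trans ?_
        exact mul_le_mul_of_nonneg_left (Real.rpow_le_rpow (Nat.cast_nonneg _) (by exact_mod_cast hqN) hδ.le)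
          (by linarith)
      have : (q : ℝ) * ((4 * C₀ * 6 ^ q.primeFactors.card / (q : ℝ) ^ 2) * L) =
          4 * C₀ * (6 : ℝ) ^ q.primeFactors.card * L * (1 / (q : ℝ)) := by
        field_simp
      rw [this]
      have h4 : 0 ≤ 4 * C₀ := by positivity
      calc 4 * C₀ * (6 : ℝ) ^ q.primeFactors.card * L * (1 / (q : ℝ))
          ≤ 4 * C₀ * (M * (N : ℝ) ^ (ε / 3)) * L * (1 / (q : ℝ)) := by
            gcongr
        _ = 4 * C₀ * M * (N : ℝ) ^ (ε / 3) * L * (1 / (q : ℝ)) := by ring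
    calc ∑ q ∈ QN, (q : ℝ) * ((4 * C₀ * 6 ^ q.primeFactors.card / (q : ℝ) ^ 2) * L)
        ≤ ∑ q ∈ QN, 4 * C₀ * M * (N : ℝ) ^ (ε / 3) * L * (1 / (q : ℝ)) := sum_le_sum hpt
      _ = 4 * C₀ * M * (N : ℝ) ^ (ε / 3) * L * ∑ q ∈ QN, (1 / (q : ℝ)) := by rw [mul_sum]
      _ ≤ 4 * C₀ * M * (N : ℝ) ^ (ε / 3) * L * ∑ q ∈ Icc 1 N, (1 / (q : ℝ)) := by
          refine mul_le_mul_of_nonneg_left ?_ (by positivity)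
          exact sum_le_sum_of_subset_of_nonneg (filter_subset _ _) fun q _ _ => by positivity
      _ ≤ 4 * C₀ * M * (N : ℝ) ^ (ε / 3) * L * L := by
          refine mul_le_mul_of_nonneg_left ?_ (by positivity)
          have h := harmonic_le_one_add_log N
          rw [harmonic_eq_sum_Icc] at h
          push_cast at h
          simpa only [one_div] using h
  -- assembling
  have hfin : 4 * C₀ * M * (N : ℝ) ^ (ε / 3) * L * L ≤
      4 * C₀ * M * (1 + 1 / (ε / 3)) ^ 2 * (N : ℝ) ^ ε := by
    have hNε : (N : ℝ) ^ (ε / 3) * (N : ℝ) ^ (ε / 3) * (N : ℝ) ^ (ε / 3) = (N : ℝ) ^ ε := by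
      rw [← Real.rpow_add hNpos, ← Real.rpow_add hNpos]; ring_nf
    calc 4 * C₀ * M * (N : ℝ) ^ (ε / 3) * L * L
        ≤ 4 * C₀ * M * (N : ℝ) ^ (ε / 3) * ((1 + 1 / (ε / 3)) * (N : ℝ) ^ (ε / 3)) *
            ((1 + 1 / (ε / 3)) * (N : ℝ) ^ (ε / 3)) := by
          gcongr
      _ = 4 * C₀ * M * (1 + 1 / (ε / 3)) ^ 2 * ((N : ℝ) ^ (ε / 3) * (N : ℝ) ^ (ε / 3) * (N : ℝ) ^ (ε / 3)) := by
          ring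
      _ = 4 * C₀ * M * (1 + 1 / (ε / 3)) ^ 2 * (N : ℝ) ^ ε := by rw [hNε]
  calc ∑ D ∈ R, (hmax D : ℝ) / ((radical D.natAbs : ℕ) : ℝ)
      ≤ 324 * ∑ D ∈ R, (classNumber D : ℝ) * (depthRad D.natAbs : ℝ) / (D.natAbs : ℝ) := step1
    _ ≤ 324 * (4 * C₀ * M * (1 + 1 / (ε / 3)) ^ 2 * (N : ℝ) ^ ε) := by
        refine mul_le_mul_of_nonneg_left ?_ (by norm_num)
        exact step2.trans (step3.trans (step4.trans hfin))
    _ = 324 * (4 * C₀ * M * (1 + 1 / (ε / 3)) ^ 2) * (N : ℝ) ^ ε := by ring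

end Summit.ABC.ABC.Theorems.SharpModerateLaw

end
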